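import Summits.QuantumFields.YangMills.Theorems.BalabanUVNodesK2OwnNumbersDefs

/-!
# CRIT-1 g5 — P1 CERTIFICATE for idea-1 g11 `approximant-laplace-squeeze` (K2⁷ `EndpointGivenBR13SepCoPH`, stmt-QuantumFields-20543)

Critic probe (seat `ym-nodeO-crit-1` gen 5, refuter-ym-nodeO-crit-1-g5-0), companion of the verdict sheet
`Cruxes/EndpointGivenBR13SepCoPH/CRIT-1-TRIAGE-approximant-laplace-squeeze.md` §4.

CLAIM CERTIFIED (P1): the TYPED ∃βf-package of `Cruxes/EndpointGivenBR13SepCoPH/ApproximantLaplaceSketch.lean` (:46 `FinLaplace`, :51 `ThermoRate`,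
:271 `ApproxLaplacePkg` — copied VERBATIM below into a separate namespace, since crux workfiles are not importable modules) is EQUIVALENT to the
mechanism-free currency `LastEntryModulus β` := «∃ history-free numbers `b`, a box `γ̄ > 0` and a monotone modulus `ω → 0` at `0⁺` with
`|β k v − b k| ≤ ω (v last)` on `HistBox γ̄ k`, every `k`» — i.e. [I] (0.31) p.259 with the quadratic rate `β₁g²` relaxed to a modulus.
(⇒) is the card's own squeeze (proof pattern = kernel §1); (⇐) uses FAKE «finite-volume β's» `βf r k v := if v last ≤ δ r then b k else β k v`.
So the package text carries no approximant content; the approximants live one level below (`FinLaplace13 ∧ ThermoRate13 ⟹ pkg`, kernel `pkg_of_record`).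

HONEST FRAMING: real analysis on ℝ only; nothing of Bałaban's is asserted or proved; every `def … : Prop` here is a hypothesis SHAPE; K2⁷ OPEN;
NODE O = [I] Thm 2 ∕ (0.31) p.259 UNPROVED IN PRINT; route R4 closes only the CONDITIONAL finite-𝕋⁴ rung `BalabanLadder.UV`; the Yang–Mills mass gap
(Clay) is NOT proved by any of this.
-/

noncomputable section

namespace Summit.QuantumFields.YangMills.Cruxes.EndpointGivenBR13SepCoPH.ApproximantLaplaceCrit1

open Filter Topology
open Literature.MathematicalPhysics.QuantumFieldTheory.Balaban1983to89.FlowStep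
open Literature.MathematicalPhysics.QuantumFieldTheory.Balaban1983to89.B12Beta (HistBox)

/-- VERBATIM COPY of the kernel's HYP A shape `FinLaplace` (:46). Hypothesis shape. [cite: Balaban1987RG1, (2.12)–(2.14) p.268 and (1.3) p.260] -/
def FinLaplace (βf : ℕ → HBeta) (b0f : ℕ → ℕ → ℝ) (C : ℕ → ℝ) (γbar : ℝ) : Prop :=
  ∀ (r k : ℕ) (v : Fin (k + 1) → ℝ), v ∈ HistBox γbar k → |βf r k v - b0f r k| ≤ C r * v (Fin.last k) ^ 2

/-- VERBATIM COPY of the kernel's HYP B shape `ThermoRate` (:51). Hypothesis shape. [cite: Balaban1987RG1, (1.21) p.264 and (1.18)–(1.19) p.263] -/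
def ThermoRate (β : HBeta) (βf : ℕ → HBeta) (τ : ℕ → ℝ) (γbar : ℝ) : Prop :=
  ∀ (r k : ℕ) (v : Fin (k + 1) → ℝ), v ∈ HistBox γbar k → |βf r k v - β k v| ≤ τ r

/-- VERBATIM COPY of the kernel's package `ApproxLaplacePkg` (:271) — the first conjunct of stub text 1ᴬᴸ `ApproxLaplace13` at a tuple. -/
def ApproxLaplacePkg (β : HBeta) : Prop :=
  ∃ (βf : ℕ → HBeta) (b0f : ℕ → ℕ → ℝ) (C τ : ℕ → ℝ) (γbar : ℝ),
    0 < γbar ∧ (∀ r, 0 ≤ C r) ∧ Antitone τ ∧ Tendsto τ atTop (𝓝 0) ∧ FinLaplace βf b0f C γbar ∧ ThermoRate β βf τ γbar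

/-- **THE MECHANISM-FREE CURRENCY (CRIT-1 P1)** — k-UNIFORM LAST-ENTRY MODULUS at history-free numbers: `|β_{k+1}(v) − b_k| ≤ ω(g_k)` on a fixed box,
`ω` monotone with `ω → 0` at `0⁺`; print's (0.31) p.259 is the case `ω(g) = β₁g²`. Hypothesis shape. [cite: Balaban1987RG1, Thm 2 (0.31) p.259] -/
def LastEntryModulus (β : HBeta) : Prop :=
  ∃ (b : ℕ → ℝ) (γbar : ℝ) (ω : ℝ → ℝ), 0 < γbar ∧ Monotone ω ∧ Tendsto ω (𝓝[>] 0) (𝓝 0) ∧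
    ∀ (k : ℕ) (v : Fin (k + 1) → ℝ), v ∈ HistBox γbar k → |β k v - b k| ≤ ω (v (Fin.last k))

/-! ## (⇐) FAKE APPROXIMANTS: any β with a last-entry modulus has a «package» -/

/-- **P1 (⇐)**: `LastEntryModulus β → ApproxLaplacePkg β`, with `βf r k v := if v last ≤ δ r then b k else β k v`, `δ r := γ̄∕(r+2)`, `τ r := ω (δ r)`,
`C r := max (ω γ̄) 0 ∕ (δ r)²`, `b0f r k := b k` — no finite-volume object anywhere. [folklore] -/
theorem pkg_of_lastEntryModulus {β : HBeta} (h : LastEntryModulus β) : ApproxLaplacePkg β := by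
  classical
  obtain ⟨b, γbar, ω, hγ, hmono, hω0, hle⟩ := h
  set δ : ℕ → ℝ := fun r => γbar / ((r : ℝ) + 2) with hδ
  have hδpos : ∀ r, 0 < δ r := fun r => div_pos hγ (by positivity)
  have hδle : ∀ r, δ r ≤ γbar := fun r => by
    rw [hδ]; dsimp only
    rw [div_le_iff₀ (by positivity)]
    nlinarith [(Nat.cast_nonneg r : (0:ℝ) ≤ r)]
  have hδanti : Antitone δ := fun r r' hrr' => by
    rw [hδ]; dsimp only
    apply div_le_div_of_nonneg_left hγ.le (by positivity)
    have : (r : ℝ) ≤ r' := by exact_mod_cast hrr'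
    linarith
  have hωnn : ∀ g, 0 < g → g ≤ γbar → 0 ≤ ω g := fun g hg hgγ => by
    have hv : (fun _ : Fin (0 + 1) => g) ∈ HistBox γbar 0 := fun _ => ⟨hg, hgγ⟩
    exact (abs_nonneg _).trans (hle 0 _ hv)
  refine ⟨fun r k v => if v (Fin.last k) ≤ δ r then b k else β k v, fun _ k => b k,
    fun r => max (ω γbar) 0 / (δ r) ^ 2, fun r => ω (δ r), γbar, hγ, fun r => by positivity,
    fun r r' hrr' => hmono (hδanti hrr'), ?_, ?_, ?_⟩
  · -- τ r = ω (δ r) → 0 : δ → 0⁺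
    have hδt : Tendsto δ atTop (𝓝[>] 0) := by
      rw [tendsto_nhdsWithin_iff]
      refine ⟨?_, Eventually.of_forall fun r => hδpos r⟩
      have h1 : Tendsto (fun r : ℕ => (r : ℝ) + 2) atTop atTop := tendsto_natCast_atTop_atTop.atTop_add tendsto_const_nhds
      exact tendsto_const_nhds.div_atTop h1
    exact hω0.comp hδt
  · -- FinLaplace with the fake approximants
    intro r k v hv
    by_cases hc : v (Fin.last k) ≤ δ r
    · simp only [hc, if_true, sub_self, abs_zero]; positivity
    · simp only [hc, if_false]
      push Not at hc
      have hvk := hv (Fin.last k)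
      have hδ2 : 0 < δ r ^ 2 := by positivity
      calc |β k v - b k| ≤ ω (v (Fin.last k)) := hle k v hv
        _ ≤ max (ω γbar) 0 := (hmono hvk.2).trans (le_max_left _ _)
        _ = max (ω γbar) 0 / δ r ^ 2 * δ r ^ 2 := (div_mul_cancel₀ _ hδ2.ne').symm
        _ ≤ max (ω γbar) 0 / δ r ^ 2 * v (Fin.last k) ^ 2 := by
            apply mul_le_mul_of_nonneg_left _ (by positivity)
            exact pow_le_pow_left₀ (hδpos r).le hc.le 2
  · -- ThermoRate with the fake approximants
    intro r k v hv
    by_cases hc : v (Fin.last k) ≤ δ r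
    · simp only [hc, if_true]
      rw [abs_sub_comm]
      exact (hle k v hv).trans (hmono hc)
    · simp only [hc, if_false, sub_self, abs_zero]
      exact hωnn _ (hδpos r) (hδle r)

/-! ## (⇒) the card's squeeze, re-run: the package yields a last-entry modulus -/

/-- Elementary: `X ≤ Y + D·g²` for all `g ∈ ]0, γ̄]` forces `X ≤ Y` (kernel `le_of_forall_sq`, re-proved by a limit). [folklore] -/
theorem le_of_forall_sq {X Y D γbar : ℝ} (hγ : 0 < γbar)
    (h : ∀ g : ℝ, 0 < g → g ≤ γbar → X ≤ Y + D * g ^ 2) : X ≤ Y := by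
  have ht : Tendsto (fun g : ℝ => Y + D * g ^ 2) (𝓝[>] 0) (𝓝 (Y + D * 0 ^ 2)) :=
    ((tendsto_const_nhds.add (tendsto_const_nhds.mul ((continuous_pow 2).tendsto 0))).mono_left nhdsWithin_le_nhds)
  simp only [ne_eq, OfNat.ofNat_ne_zero, not_false_eq_true, zero_pow, mul_zero, add_zero] at ht
  have hev : ∀ᶠ g in 𝓝[>] (0 : ℝ), X ≤ Y + D * g ^ 2 := by
    have h1 : ∀ᶠ g in 𝓝[>] (0 : ℝ), g ∈ Set.Ioo 0 γbar := Ioo_mem_nhdsGT hγ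
    exact h1.mono fun g hg => h g hg.1 hg.2.le
  exact ge_of_tendsto ht hev

/-- **P1 (⇒)**: `ApproxLaplacePkg β → LastEntryModulus β` with `ω g := ⨅ r, (2·τ r + C r·(max g 0)²)` at the limiting numbers `b∞` — exactly the
card's squeeze `|β − b∞| ≤ 2τ(r) + C(r)g²`, infimised over the depth. [folklore] -/
theorem lastEntryModulus_of_pkg {β : HBeta} (h : ApproxLaplacePkg β) : LastEntryModulus β := by
  obtain ⟨βf, b0f, C, τ, γbar, hγ, hC, hτ, hτ0, hA, hB⟩ := h
  have hτnn : ∀ r, 0 ≤ τ r := fun r => hτ.le_of_tendsto hτ0 r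
  -- Step 1: `|b0f r k − b0f r' k| ≤ τ r + τ r'` (compare at constant histories, send the coupling to 0).
  have hdist : ∀ k r r', |b0f r k - b0f r' k| ≤ τ r + τ r' := by
    intro k r r'
    refine le_of_forall_sq (D := C r + C r') hγ fun g hg hgle => ?_
    set v : Fin (k + 1) → ℝ := fun _ => g
    have hv : v ∈ HistBox γbar k := fun _ => ⟨hg, hgle⟩
    have e1 := hA r k v hv; have e2 := hB r k v hv; have e3 := hB r' k v hv; have e4 := hA r' k v hv
    have hlast : v (Fin.last k) = g := rfl
    rw [hlast] at e1 e4
    rw [abs_le] at e1 e2 e3 e4 ⊢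
    constructor <;> nlinarith
  -- Step 2: limits `b∞ k` with `|b0f r k − b∞ k| ≤ τ r`.
  have hk : ∀ k, ∃ L : ℝ, ∀ r, |b0f r k - L| ≤ τ r := by
    intro k
    have hcs : CauchySeq (fun r => b0f r k) := by
      refine cauchySeq_of_le_tendsto_0 (fun N => τ N + τ N) (fun n m N hn hm => ?_) (by simpa using hτ0.add hτ0)
      rw [Real.dist_eq]
      exact (hdist k n m).trans (add_le_add (hτ hn) (hτ hm))
    obtain ⟨L, hL⟩ := cauchySeq_tendsto_of_complete hcs
    refine ⟨L, fun r => ?_⟩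
    have h1 : Tendsto (fun r' => |b0f r k - b0f r' k|) atTop (𝓝 |b0f r k - L|) := (tendsto_const_nhds.sub hL).abs
    have h2 : Tendsto (fun r' => τ r + τ r') atTop (𝓝 (τ r + 0)) := tendsto_const_nhds.add hτ0
    simpa using le_of_tendsto_of_tendsto' h1 h2 (fun r' => hdist k r r')
  choose bInf hb using hk
  -- Step 3: the squeeze `|β k v − b∞ k| ≤ 2τ r + C r·(v last)²` for every `r`.
  have hsq : ∀ r k v, v ∈ HistBox γbar k → |β k v - bInf k| ≤ 2 * τ r + C r * v (Fin.last k) ^ 2 := by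
    intro r k v hv
    have e1 := hA r k v hv; have e2 := hB r k v hv; have e3 := hb k r
    rw [abs_le] at e1 e2 e3 ⊢
    constructor <;> nlinarith
  -- Step 4: the modulus.
  set ω : ℝ → ℝ := fun g => ⨅ r, (2 * τ r + C r * (max g 0) ^ 2) with hω
  have hbdd : ∀ g, BddBelow (Set.range fun r => 2 * τ r + C r * (max g 0) ^ 2) := fun g =>
    ⟨0, by rintro _ ⟨r, rfl⟩; exact add_nonneg (by linarith [hτnn r]) (mul_nonneg (hC r) (sq_nonneg _))⟩
  have hωle : ∀ g r, ω g ≤ 2 * τ r + C r * (max g 0) ^ 2 := fun g r => ciInf_le (hbdd g) r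
  have hωnn : ∀ g, 0 ≤ ω g := fun g =>
    le_ciInf fun r => add_nonneg (by linarith [hτnn r]) (mul_nonneg (hC r) (sq_nonneg _))
  refine ⟨bInf, γbar, ω, hγ, ?_, ?_, ?_⟩
  · -- monotone
    intro g g' hgg'
    refine le_ciInf fun r => (hωle g r).trans ?_
    have : (max g 0) ^ 2 ≤ (max g' 0) ^ 2 := pow_le_pow_left₀ (le_max_right _ _) (max_le_max hgg' le_rfl) 2
    nlinarith [hC r]
  · -- ω → 0 at 0⁺ : given ε, pick r with 2τ r < ε/2, then g small
    rw [Metric.tendsto_nhdsWithin_nhds]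
    intro ε hε
    have hτev : ∀ᶠ r in atTop, τ r < ε / 4 := (tendsto_order.1 hτ0).2 _ (by positivity)
    obtain ⟨r, hr⟩ := hτev.exists
    have hC1 : 0 < C r + 1 := by linarith [hC r]
    refine ⟨min 1 (Real.sqrt (ε / (4 * (C r + 1)))), lt_min one_pos (Real.sqrt_pos.2 (by positivity)), fun g hg hdg => ?_⟩
    rw [Real.dist_eq, sub_zero, abs_of_nonneg (hωnn g)]
    rw [Real.dist_eq, sub_zero] at hdg
    have hg0 : 0 < g := hg
    have hg1 : |g| < Real.sqrt (ε / (4 * (C r + 1))) := lt_of_lt_of_le hdg (min_le_right _ _)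
    rw [abs_of_pos hg0] at hg1
    have hg2 : g ^ 2 < ε / (4 * (C r + 1)) := by
      have hs : 0 ≤ Real.sqrt (ε / (4 * (C r + 1))) := Real.sqrt_nonneg _
      have := mul_self_lt_mul_self hg0.le hg1
      rw [← pow_two, ← pow_two, Real.sq_sqrt (by positivity)] at this
      exact this
    have hmax : max g 0 = g := max_eq_left hg0.le
    calc ω g ≤ 2 * τ r + C r * (max g 0) ^ 2 := hωle g r
      _ = 2 * τ r + C r * g ^ 2 := by rw [hmax]
      _ ≤ 2 * τ r + (C r + 1) * g ^ 2 := by nlinarith [sq_nonneg g]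
      _ < 2 * (ε / 4) + (C r + 1) * (ε / (4 * (C r + 1))) := by
          have := mul_lt_mul_of_pos_left hg2 hC1
          nlinarith
      _ = ε / 2 + ε / 4 := by field_simp; ring
      _ < ε := by linarith
  · intro k v hv
    refine le_ciInf fun r => ?_
    have hmax : max (v (Fin.last k)) 0 = v (Fin.last k) := max_eq_left (hv (Fin.last k)).1.le
    rw [hmax]
    exact hsq r k v hv

/-- **P1** — the typed package IS the last-entry modulus, both ways. [folklore] -/
theorem pkg_iff_lastEntryModulus (β : HBeta) : ApproxLaplacePkg β ↔ LastEntryModulus β :=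
  ⟨lastEntryModulus_of_pkg, pkg_of_lastEntryModulus⟩

end Summit.QuantumFields.YangMills.Cruxes.EndpointGivenBR13SepCoPH.ApproximantLaplaceCrit1
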